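import Mathlib
import HarnessLib
import Literature.Analysis.FluidPDE.SelfSimilar
import Literature.Analysis.FluidPDE.TypeIAncientMild
import Summits.NavierStokesRegularity.NavierStokesRegularity.Theorems.QuarterLogPincerTruncationEdgeDefs
import Summits.NavierStokesRegularity.NavierStokesRegularity.Theorems.QuarterLogPincerQuietCollarDefs
import Summits.NavierStokesRegularity.NavierStokesRegularity.Theorems.QuarterLogPincerQuietCollarSpikeTools
import Summits.NavierStokesRegularity.NavierStokesRegularity.Theorems.QuarterLogPincerQuietCollarLever

/-!
# Route `QuarterLogPincer`, crux `TypeIQuantSubcubicExp` (stmt-NavierStokesRegularity-24077), line `quiet_collar` — QP1 WITH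
# EXPLICIT CONSTANTS, and THE LOG-BEATING QUIET COLLAR (QP1⁺)

`Theorems/QuarterLogPincerQuietCollarLever.lean` proves QP1 `stub_quietCollar : StubQuietCollar` with OPAQUE `∃ κ₁ K₁`.  The
composition `farFieldTruncation_of_quietAnatomy` of the line requests QP1 WITH QP2's constants (`h1 k₂ K₂`), so the radius at which
QP2 `CutPair` is applied is `≤ K₁(K₂)·ε^{−κ₁(k₂)}` — unknown to QP2.  The typed audit of QP2 (pub-ns-dss bus 2026-08-29T01:10Z,
typer g36) shows the data error of the cut pair carries an UNAVOIDABLE factor `log r` (r = collar radius), absorbable only on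
QP1's side, where `K₁` is explicit.  This file supplies exactly that:

* `quietCollar_explicit` — QP1 with its constants EXPOSED: one `C_v ≥ 1` (from the budget constant `B`, the slab Lipschitz
  constant `D₀`, `|B₁|`) such that for every request `(k, K)` the collar radius obeys `r + Lq ≤ (C_v·K¹⁶ + 3K + 6)·ε^{−(16k+18)}`
  (same proof as the Lever's §6, constants kept symbolic);
* `quietCollar_log` — **QP1⁺, THE LOG-BEATING QUIET COLLAR**: for every `(k, K)` there are `κ₁ = 16k + 34`, `K₁` with, for all
  `ε ∈ (0,1/2]`, `ηq ≥ εᵏ/K`, `0 < Lq ≤ Kε^{−k}`, a collar `{r ≤ |x| ≤ r + Lq}`, `2 ≤ r`, `r + Lq ≤ K₁ε^{−κ₁}`, on which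
  `‖v(s,x)‖ ≤ ηq / (1 + log r)` for all `s ∈ [−1,−ε]` (apply `quietCollar_explicit` with the request `(k+1, K⁺)`,
  `K⁺ = (64K)² + 2K(17 + 16k + log(C_v + 9))`, at level `ηq/(1 + log(K₁ε^{−κ₁}))`; the point is `ε·(1 + log K₁(K⁺) + κ₁) ·K ≤ K⁺`,
  i.e. a log of the radius is absorbed by one extra power of `ε` and a larger `K`).  This is VERBATIM the body of the proposed
  v1.6 `QuietCollar` (level `ηq / (1 + Real.log r)`), so that the re-typed QP1 is the one-liner `quietCollar_log hv hB`.

HONEST FRAME: covering lemmas about HYPOTHETICAL Type-I ancient mild fields with a log-shaped cube budget; nothing here bears on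
24077, W7 or Navier–Stokes regularity (OPEN).  Helper of the pub-ns-dss typer (g36), `--supports 24077`.
-/

noncomputable section

set_option linter.dupNamespace false

namespace Summit.NavierStokesRegularity.NavierStokesRegularity.Cruxes.TypeIQuantSubcubicExp.QuietCollar

open MeasureTheory Set Function Filter Real Metric
open scoped ENNReal NNReal Topology
open Literature.Analysis Literature.Analysis.FluidPDE
open Summit.NavierStokesRegularity.NavierStokesRegularity.Cruxes.TypeIQuantSubcubicExp.TruncationEdge

/-! ### 1. QP1 with explicit constants -/

set_option maxHeartbeats 800000 in
/-- **QP1 WITH EXPLICIT CONSTANTS.**  For a Type-I ancient mild field with the log-shaped cube budget there is ONE `C ≥ 1`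
(namely `max 1 (3·(43008(B+1)D₀⁴/|B₁|)²)`) such that for every polynomial request `(k, K)`, every `ε ∈ (0,1/2]`, every quietness
`ηq ≥ εᵏ/K` and width `0 < Lq ≤ Kε^{−k}` there is a collar `{r ≤ |x| ≤ r + Lq}`, `2 ≤ r`,
`r + Lq ≤ (C·K¹⁶ + 3K + 6)·ε^{−(16k+18)}`, on which `‖v(s,x)‖ ≤ ηq` for all `s ∈ [−1,−ε]` (the Lever's §6 with the constants
kept symbolic). [this file; folklore bookkeeping over `exists_quietCollar_of_key`] -/
theorem quietCollar_explicit {M : ℝ} {v : ℝ → EuclideanSpace ℝ (Fin 3) → EuclideanSpace ℝ (Fin 3)}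
    (hv : IsTypeIAncientMild M v) (hbud : EnvelopeCubeBudget v) :
    ∃ C : ℝ, 1 ≤ C ∧ ∀ k K : ℝ, 0 ≤ k → 1 ≤ K →
      ∀ ε ∈ Set.Ioc (0 : ℝ) (1 / 2), ∀ ηq Lq : ℝ, ε ^ k / K ≤ ηq → 0 < Lq → Lq ≤ K * ε ^ (-k) →
        ∃ r : ℝ, 2 ≤ r ∧ r + Lq ≤ (C * K ^ (16 : ℕ) + 3 * K + 6) * ε ^ (-(16 * k + 18)) ∧
          ∀ s ∈ Set.Icc (-1 : ℝ) (-ε), ∀ x : EuclideanSpace ℝ (Fin 3),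
            r ≤ ‖x‖ → ‖x‖ ≤ r + Lq → ‖v s x‖ ≤ ηq := by
  obtain ⟨B, hB, hbudB⟩ := hbud
  obtain ⟨D₀, hD₀, hLip⟩ := exists_slab_lipschitz hv
  obtain ⟨V₁, hV₁⟩ : ∃ V₁ : ℝ, V₁ = volume.real (Metric.ball (0 : EuclideanSpace ℝ (Fin 3)) 1) := ⟨_, rfl⟩
  have hV : 0 < V₁ := by
    rw [hV₁]; exact ENNReal.toReal_pos (measure_ball_pos volume _ one_pos).ne' measure_ball_lt_top.ne
  obtain ⟨c, hc⟩ : ∃ c : ℝ, c = 43008 * (B + 1) * D₀ ^ 4 / V₁ := ⟨_, rfl⟩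
  have hc0 : 0 < c := by rw [hc]; positivity
  refine ⟨max 1 (3 * c ^ 2), le_max_left _ _, ?_⟩
  intro k K hk hK
  rintro ε ⟨hε, hε2⟩ ηq Lq hηq hLq hLqK
  have hε1 : ε ≤ 1 := by linarith
  have hK0 : 0 < K := by linarith
  -- `C₀ = c K⁸`
  obtain ⟨C₀, hC₀⟩ : ∃ C₀ : ℝ, C₀ = c * K ^ 8 := ⟨_, rfl⟩
  have hC₀0 : 0 < C₀ := by rw [hC₀]; positivity
  -- the request at its extreme values `η₀ = εᵏ/K`, `L₀ = K ε^{-k} = K/εᵏ`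
  obtain ⟨t, ht⟩ : ∃ t : ℝ, t = ε ^ k := ⟨_, rfl⟩
  have ht0 : 0 < t := by rw [ht]; exact Real.rpow_pos_of_pos hε k
  have ht1 : t ≤ 1 := by rw [ht]; exact Real.rpow_le_one hε.le hε1 hk
  have hεk : ε ^ (-k) = t⁻¹ := by rw [Real.rpow_neg hε.le, ht]
  obtain ⟨η₀, hη₀⟩ : ∃ η₀ : ℝ, η₀ = t / K := ⟨_, rfl⟩
  obtain ⟨L₀, hL₀⟩ : ∃ L₀ : ℝ, L₀ = K / t := ⟨_, rfl⟩
  have hη₀0 : 0 < η₀ := by rw [hη₀]; positivity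
  have hη₀1 : η₀ ≤ 1 := by rw [hη₀, div_le_one hK0]; linarith
  have hL₀1 : 1 ≤ L₀ := by rw [hL₀, one_le_div ht0]; linarith
  have hL₀0 : 0 < L₀ := by linarith
  have hLqL₀ : Lq ≤ L₀ := by rw [hL₀, div_eq_mul_inv, ← hεk]; exact hLqK
  -- margin, box mass, base radius
  obtain ⟨a, ha⟩ : ∃ a : ℝ, a = η₀ * ε ^ 2 / (4 * D₀) := ⟨_, rfl⟩
  obtain ⟨μ, hμ⟩ : ∃ μ : ℝ, μ = (η₀ / 2) ^ 3 * (a * (a ^ 3 * V₁)) := ⟨_, rfl⟩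
  have ha0 : 0 < a := by rw [ha]; positivity
  have ha1 : a ≤ 1 := by
    rw [ha, div_le_one (by positivity)]
    have h1 : ε ^ 2 ≤ 1 := pow_le_one₀ hε.le hε1
    calc η₀ * ε ^ 2 ≤ 1 * 1 := mul_le_mul hη₀1 h1 (by positivity) zero_le_one
      _ ≤ 4 * D₀ := by linarith
  have hμ0 : 0 < μ := by rw [hμ]; positivity
  obtain ⟨ρ, hρ⟩ : ∃ ρ : ℝ, ρ = (21 * L₀ * (B + 1) / (ε * μ)) ^ 2 + L₀ + 2 := ⟨_, rfl⟩
  have hρL : L₀ + 2 ≤ ρ := by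
    have := sq_nonneg (21 * L₀ * (B + 1) / (ε * μ)); rw [hρ]; linarith
  have hρ1 : 1 ≤ ρ := by linarith
  have hρ0 : 0 < ρ := by linarith
  obtain ⟨hLx, hLt⟩ := hLip ε hε hε1
  -- THE KEY INEQUALITY `(L₀ + 2a)·B·(1 + log R + log(2/ε)) < μρ` (verbatim from the Lever's §6)
  have hkey : (L₀ + 2 * a) * (B * (1 + Real.log (2 * ρ + L₀ + a + 1) + Real.log (2 / ε))) < μ * ρ := by
    have hsρ : 1 ≤ Real.sqrt ρ := by
      rw [show (1 : ℝ) = Real.sqrt 1 by simp]; exact Real.sqrt_le_sqrt hρ1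
    have hlogR : Real.log (2 * ρ + L₀ + a + 1) ≤ 4 * Real.sqrt ρ := by
      have hlog2 : ∀ x : ℝ, 0 < x → Real.log x ≤ 2 * Real.sqrt x := fun x hx => by
        have e1 : Real.log x = 2 * Real.log (Real.sqrt x) := by rw [Real.log_sqrt hx.le]; ring
        have e2 := Real.log_le_sub_one_of_pos (Real.sqrt_pos.mpr hx)
        linarith
      refine (hlog2 _ (by linarith)).trans ?_
      have h3 : Real.sqrt (2 * ρ + L₀ + a + 1) ≤ Real.sqrt (4 * ρ) := Real.sqrt_le_sqrt (by linarith)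
      have h4 : Real.sqrt (4 * ρ) = 2 * Real.sqrt ρ := by
        rw [Real.sqrt_mul (by norm_num), show (4 : ℝ) = 2 ^ 2 by norm_num, Real.sqrt_sq (by norm_num)]
      linarith
    have hlogε : Real.log (2 / ε) * ε ≤ 2 := by
      have h1 : Real.log (2 / ε) ≤ 2 / ε := by
        have := Real.log_le_sub_one_of_pos (show 0 < 2 / ε by positivity); linarith
      have := mul_le_mul_of_nonneg_right h1 hε.le
      rwa [div_mul_cancel₀ _ hε.ne'] at this
    have hsum : 1 + Real.log (2 * ρ + L₀ + a + 1) + Real.log (2 / ε) ≤ 7 * Real.sqrt ρ / ε := by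
      rw [le_div_iff₀ hε]
      have e1 : Real.log (2 * ρ + L₀ + a + 1) * ε ≤ 4 * Real.sqrt ρ * ε :=
        mul_le_mul_of_nonneg_right hlogR hε.le
      have e2 : 4 * Real.sqrt ρ * ε ≤ 4 * Real.sqrt ρ * (1 / 2) :=
        mul_le_mul_of_nonneg_left hε2 (by positivity)
      have e3 : (1 + Real.log (2 * ρ + L₀ + a + 1) + Real.log (2 / ε)) * ε =
          ε + Real.log (2 * ρ + L₀ + a + 1) * ε + Real.log (2 / ε) * ε := by ring
      rw [e3]
      linarith
    have hlhs : (L₀ + 2 * a) * (B * (1 + Real.log (2 * ρ + L₀ + a + 1) + Real.log (2 / ε))) ≤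
        3 * L₀ * (B * (7 * Real.sqrt ρ / ε)) := by
      have hB' : B * (1 + Real.log (2 * ρ + L₀ + a + 1) + Real.log (2 / ε)) ≤
          B * (7 * Real.sqrt ρ / ε) := mul_le_mul_of_nonneg_left hsum hB
      have hsum0 : 0 ≤ 1 + Real.log (2 * ρ + L₀ + a + 1) + Real.log (2 / ε) := by
        have h1 : 0 ≤ Real.log (2 * ρ + L₀ + a + 1) := Real.log_nonneg (by linarith)
        have h2 : 0 ≤ Real.log (2 / ε) := Real.log_nonneg (by rw [le_div_iff₀ hε]; linarith)
        linarith
      exact mul_le_mul (by linarith) hB' (mul_nonneg hB hsum0) (by positivity)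
    have hsq : 21 * L₀ * (B + 1) / (ε * μ) ≤ Real.sqrt ρ := by
      have h1 : Real.sqrt ((21 * L₀ * (B + 1) / (ε * μ)) ^ 2) ≤ Real.sqrt ρ :=
        Real.sqrt_le_sqrt (by rw [hρ]; linarith)
      rwa [Real.sqrt_sq (by positivity)] at h1
    have hstrict : 21 * L₀ * B / (ε * μ) < Real.sqrt ρ := by
      refine lt_of_lt_of_le ?_ hsq
      rw [div_lt_div_iff_of_pos_right (by positivity)]
      have e1 : 21 * L₀ * (B + 1) = 21 * L₀ * B + 21 * L₀ := by ring
      rw [e1]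
      linarith
    have hfin : 3 * L₀ * (B * (7 * Real.sqrt ρ / ε)) < μ * ρ := by
      have h1 : 3 * L₀ * (B * (7 * Real.sqrt ρ / ε)) =
          (21 * L₀ * B / (ε * μ)) * (μ * Real.sqrt ρ) := by
        field_simp
        ring
      have h2 : μ * ρ = Real.sqrt ρ * (μ * Real.sqrt ρ) := by
        rw [mul_comm (Real.sqrt ρ), mul_assoc, Real.mul_self_sqrt hρ0.le]
      rw [h1, h2]
      exact mul_lt_mul_of_pos_right hstrict (by positivity)
    exact lt_of_le_of_lt hlhs hfin
  -- the quiet collar at quietness `η₀`, width `L₀` (§5 of the Lever)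
  obtain ⟨r, hρr, hr2ρ, hquiet⟩ := exists_quietCollar_of_key (ε := ε) (η := η₀) (L := L₀) (ρ := ρ)
    (a := a) (μ := μ) hv hbudB hD₀ hε hε2 hη₀0 hη₀1 hL₀1 hρL hLx hLt ha (by rw [hμ, hV₁]) hkey
  refine ⟨r, by linarith, ?_, fun s hs x hx1 hx2 => (hquiet s hs x hx1 (by linarith)).trans ?_⟩
  · -- `r + Lq ≤ 3ρ ≤ 3(C₀² + K + 2) ε^{-κ₁} ≤ (C K¹⁶ + 3K + 6) ε^{-κ₁}`
    obtain ⟨P, hPdef⟩ : ∃ P : ℝ, P = t ^ 16 * ε ^ 18 := ⟨_, rfl⟩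
    have hP : ε ^ (-(16 * k + 18)) = P⁻¹ := by
      rw [Real.rpow_neg hε.le, Real.rpow_add hε, mul_comm (16 : ℝ) k, Real.rpow_mul hε.le, ← ht,
        show (16 : ℝ) = ((16 : ℕ) : ℝ) by norm_num, show (18 : ℝ) = ((18 : ℕ) : ℝ) by norm_num,
        Real.rpow_natCast, Real.rpow_natCast, hPdef]
    have hP0 : 0 < P := by rw [hPdef]; positivity
    have hP1 : P ≤ 1 := by
      rw [hPdef]
      exact mul_le_one₀ (pow_le_one₀ ht0.le ht1) (by positivity) (pow_le_one₀ hε.le hε1)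
    have hPt : P ≤ t := by
      rw [hPdef]
      have h1 : t ^ 16 ≤ t := by
        calc t ^ 16 = t * t ^ 15 := by ring
          _ ≤ t * 1 := mul_le_mul_of_nonneg_left (pow_le_one₀ ht0.le ht1) ht0.le
          _ = t := mul_one t
      have h2 : ε ^ 18 ≤ 1 := pow_le_one₀ hε.le hε1
      calc t ^ 16 * ε ^ 18 ≤ t * 1 := mul_le_mul h1 h2 (by positivity) ht0.le
        _ = t := mul_one t
    have hsqterm : (21 * L₀ * (B + 1) / (ε * μ)) ^ 2 = C₀ ^ 2 / P := by
      have h1 : 21 * L₀ * (B + 1) / (ε * μ) = C₀ / (t ^ 8 * ε ^ 9) := by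
        rw [hμ, ha, hη₀, hL₀, hC₀, hc]
        field_simp
        ring
      rw [h1, div_pow, hPdef]
      ring
    have hρP : ρ ≤ (C₀ ^ 2 + K + 2) / P := by
      rw [le_div_iff₀ hP0, hρ, hsqterm]
      have e1 : (C₀ ^ 2 / P + L₀ + 2) * P = C₀ ^ 2 + L₀ * P + 2 * P := by
        field_simp
      have e2 : L₀ * P ≤ K := by
        rw [hL₀, div_mul_eq_mul_div, div_le_iff₀ ht0]
        exact mul_le_mul_of_nonneg_left hPt hK0.le
      rw [e1]
      linarith
    have hC₀sq : 3 * C₀ ^ 2 ≤ max 1 (3 * c ^ 2) * K ^ (16 : ℕ) := by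
      have e1 : 3 * C₀ ^ 2 = 3 * c ^ 2 * K ^ (16 : ℕ) := by rw [hC₀]; ring
      rw [e1]
      exact mul_le_mul_of_nonneg_right (le_max_right _ _) (by positivity)
    have hPinv : 0 < P⁻¹ := inv_pos.2 hP0
    calc r + Lq ≤ 2 * ρ + L₀ := by linarith
      _ ≤ 3 * ((C₀ ^ 2 + K + 2) / P) := by linarith
      _ = (3 * C₀ ^ 2 + 3 * K + 6) * P⁻¹ := by rw [div_eq_mul_inv]; ring
      _ ≤ (max 1 (3 * c ^ 2) * K ^ (16 : ℕ) + 3 * K + 6) * P⁻¹ :=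
          mul_le_mul_of_nonneg_right (by linarith) hPinv.le
      _ = (max 1 (3 * c ^ 2) * K ^ (16 : ℕ) + 3 * K + 6) * ε ^ (-(16 * k + 18)) := by rw [hP]
  · -- `η₀ ≤ ηq`
    rw [hη₀, ht]; exact hηq

/-! ### 2. QP1⁺: the log-beating quiet collar -/

/-- **QP1⁺ — THE LOG-BEATING QUIET COLLAR.**  For a Type-I ancient mild field with the log-shaped cube budget and every
polynomial request `(k, K)` there are `κ₁ (= 16k + 34)`, `K₁` such that for every `ε ∈ (0,1/2]`, `ηq ≥ εᵏ/K`, `0 < Lq ≤ Kε^{−k}`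
there is a collar `{r ≤ |x| ≤ r + Lq}`, `2 ≤ r`, `r + Lq ≤ K₁ε^{−κ₁}`, on which `‖v(s,x)‖ ≤ ηq / (1 + log r)` for all
`s ∈ [−1,−ε]`: the quietness BEATS THE LOGARITHM OF THE RADIUS (`quietCollar_explicit` with the request `(k+1, K⁺)`,
`K⁺ = (64K)² + 2K·(35 + 16k + log(C+9))`, at level `ηq/(1 + log(K₁ε^{−κ₁}))`, using `ε(1 + log K₁(K⁺) + κ₁)·K ≤ K⁺`).  VERBATIM the
body of the v1.6 `QuietCollar` proposed on the pub-ns-dss bus (2026-08-29T01:10Z). [this file] -/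
theorem quietCollar_log {M : ℝ} {v : ℝ → EuclideanSpace ℝ (Fin 3) → EuclideanSpace ℝ (Fin 3)}
    (hv : IsTypeIAncientMild M v) (hbud : EnvelopeCubeBudget v) :
    ∀ k K : ℝ, 0 ≤ k → 1 ≤ K → ∃ κ₁ K₁ : ℝ, 0 ≤ κ₁ ∧ 2 ≤ K₁ ∧
      ∀ ε ∈ Set.Ioc (0 : ℝ) (1 / 2), ∀ ηq Lq : ℝ, ε ^ k / K ≤ ηq → 0 < Lq → Lq ≤ K * ε ^ (-k) →
        ∃ r : ℝ, 2 ≤ r ∧ r + Lq ≤ K₁ * ε ^ (-κ₁) ∧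
          ∀ s ∈ Set.Icc (-1 : ℝ) (-ε), ∀ x : EuclideanSpace ℝ (Fin 3),
            r ≤ ‖x‖ → ‖x‖ ≤ r + Lq → ‖v s x‖ ≤ ηq / (1 + Real.log r) := by
  obtain ⟨C, hC1, hcol⟩ := quietCollar_explicit hv hbud
  intro k K hk hK
  have hK0 : 0 < K := by linarith
  -- the enlarged request constant `K⁺ = (64K)² + 2KΘ`, `Θ = 1 + κ₁ + log(C+9)`, `κ₁ = 16(k+1) + 18`
  have hlogC9 : 0 ≤ Real.log (C + 9) := Real.log_nonneg (by linarith)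
  obtain ⟨Θ, hΘ⟩ : ∃ Θ : ℝ, Θ = 1 + (16 * (k + 1) + 18) + Real.log (C + 9) := ⟨_, rfl⟩
  have hΘ1 : 1 ≤ Θ := by rw [hΘ]; nlinarith
  obtain ⟨K', hK'⟩ : ∃ K' : ℝ, K' = (64 * K) ^ 2 + 2 * K * Θ := ⟨_, rfl⟩
  have hK'K : K ≤ K' := by rw [hK']; nlinarith
  have hK'1 : 1 ≤ K' := hK.trans hK'K
  have hK'0 : 0 < K' := by linarith
  obtain ⟨K₁, hK₁⟩ : ∃ K₁ : ℝ, K₁ = C * K' ^ (16 : ℕ) + 3 * K' + 6 := ⟨_, rfl⟩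
  have hK₁2 : 2 ≤ K₁ := by
    rw [hK₁]; have : 0 ≤ C * K' ^ (16 : ℕ) := by positivity
    nlinarith
  have hK₁1 : 1 ≤ K₁ := by linarith
  refine ⟨16 * (k + 1) + 18, K₁, by positivity, hK₁2, ?_⟩
  rintro ε ⟨hε, hε2⟩ ηq Lq hηq hLq hLqK
  have hε1 : ε ≤ 1 := by linarith
  -- `Λ = 1 + log(K₁ ε^{-κ₁}) ≥ 1 + log r` for every admissible radius
  obtain ⟨Λ, hΛ⟩ : ∃ Λ : ℝ, Λ = 1 + Real.log (K₁ * ε ^ (-(16 * (k + 1) + 18))) := ⟨_, rfl⟩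
  have hpow : 1 ≤ ε ^ (-(16 * (k + 1) + 18)) :=
    Real.one_le_rpow_of_pos_of_le_one_of_nonpos hε hε1 (by linarith)
  have hK₁ε : 1 ≤ K₁ * ε ^ (-(16 * (k + 1) + 18)) := by nlinarith
  have hΛ1 : 1 ≤ Λ := by rw [hΛ]; linarith [Real.log_nonneg hK₁ε]
  have hΛ0 : 0 < Λ := by linarith
  have hlogexp : Real.log (K₁ * ε ^ (-(16 * (k + 1) + 18))) =
      Real.log K₁ - (16 * (k + 1) + 18) * Real.log ε := by
    rw [Real.log_mul (by positivity) (by positivity), Real.log_rpow hε]; ring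
  -- `ε Λ ≤ 1 + log K₁ + κ₁`
  have hεlog : -(Real.log ε * ε) ≤ 1 := by
    have h1 := Real.abs_log_mul_self_lt ε hε hε1
    have h2 := neg_abs_le (Real.log ε * ε)
    linarith
  have hlogK₁ : 0 ≤ Real.log K₁ := Real.log_nonneg hK₁1
  have hεΛ : ε * Λ ≤ 1 + Real.log K₁ + (16 * (k + 1) + 18) := by
    rw [hΛ, hlogexp]
    have e1 : ε * (1 + (Real.log K₁ - (16 * (k + 1) + 18) * Real.log ε)) =
        ε + ε * Real.log K₁ + (16 * (k + 1) + 18) * (-(Real.log ε * ε)) := by ring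
    rw [e1]
    have e2 : ε * Real.log K₁ ≤ 1 * Real.log K₁ := mul_le_mul_of_nonneg_right hε1 hlogK₁
    have e3 : (16 * (k + 1) + 18) * (-(Real.log ε * ε)) ≤ (16 * (k + 1) + 18) * 1 :=
      mul_le_mul_of_nonneg_left hεlog (by linarith)
    linarith
  -- `log K₁ ≤ log(C+9) + 32 √K⁺`
  have hlogK₁le : Real.log K₁ ≤ Real.log (C + 9) + 32 * Real.sqrt K' := by
    have h1 : K₁ ≤ (C + 9) * K' ^ (16 : ℕ) := by
      rw [hK₁]
      have hp1 : 1 ≤ K' ^ (16 : ℕ) := one_le_pow₀ hK'1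
      have hp2 : K' ≤ K' ^ (16 : ℕ) := by
        calc K' = K' ^ 1 := (pow_one _).symm
          _ ≤ K' ^ (16 : ℕ) := pow_le_pow_right₀ hK'1 (by norm_num)
      nlinarith
    have h2 : Real.log K₁ ≤ Real.log ((C + 9) * K' ^ (16 : ℕ)) := Real.log_le_log (by linarith) h1
    rw [Real.log_mul (by positivity) (by positivity), Real.log_pow] at h2
    have h3 : Real.log K' ≤ 2 * Real.sqrt K' := by
      have e1 : Real.log K' = 2 * Real.log (Real.sqrt K') := by rw [Real.log_sqrt hK'0.le]; ring
      have e2 := Real.log_le_sub_one_of_pos (Real.sqrt_pos.mpr hK'0)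
      linarith
    push_cast at h2
    linarith
  -- `32 K √K⁺ ≤ K⁺/2` and `K Θ ≤ K⁺/2`, whence `ε Λ K ≤ K⁺`
  have hsqrtK' : 64 * K ≤ Real.sqrt K' := by
    have h1 : Real.sqrt ((64 * K) ^ 2) ≤ Real.sqrt K' := Real.sqrt_le_sqrt (by rw [hK']; nlinarith)
    rwa [Real.sqrt_sq (by positivity)] at h1
  have hhalf1 : 32 * K * Real.sqrt K' ≤ K' / 2 := by
    have h1 : 32 * K * Real.sqrt K' ≤ (Real.sqrt K' / 2) * Real.sqrt K' :=
      mul_le_mul_of_nonneg_right (by linarith) (Real.sqrt_nonneg _)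
    rwa [div_mul_eq_mul_div, Real.mul_self_sqrt hK'0.le] at h1
  have hhalf2 : K * Θ ≤ K' / 2 := by rw [hK']; nlinarith [sq_nonneg (64 * K)]
  have hmain : ε * Λ * K ≤ K' := by
    have h1 : ε * Λ * K ≤ (1 + Real.log K₁ + (16 * (k + 1) + 18)) * K :=
      mul_le_mul_of_nonneg_right hεΛ hK0.le
    have h2 : (1 + Real.log K₁ + (16 * (k + 1) + 18)) * K ≤ (Θ + 32 * Real.sqrt K') * K := by
      refine mul_le_mul_of_nonneg_right ?_ hK0.le
      rw [hΘ]; linarith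
    have h3 : (Θ + 32 * Real.sqrt K') * K = K * Θ + 32 * K * Real.sqrt K' := by ring
    linarith
  -- the explicit collar with the request `(k+1, K⁺)` at level `ηq/Λ` and width `Lq`
  have hηq0 : 0 < ηq := lt_of_lt_of_le (by positivity) hηq
  have hreq1 : ε ^ (k + 1) / K' ≤ ηq / Λ := by
    rw [div_le_div_iff₀ hK'0 hΛ0, Real.rpow_add hε, Real.rpow_one]
    have h1 : ε ^ k ≤ ηq * K := by rwa [div_le_iff₀ hK0] at hηq
    calc ε ^ k * ε * Λ = ε ^ k * (ε * Λ) := by ring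
      _ ≤ (ηq * K) * (ε * Λ) := mul_le_mul_of_nonneg_right h1 (by positivity)
      _ = ηq * (ε * Λ * K) := by ring
      _ ≤ ηq * K' := mul_le_mul_of_nonneg_left hmain hηq0.le
  have hreq2 : Lq ≤ K' * ε ^ (-(k + 1)) := by
    refine hLqK.trans ?_
    have h1 : ε ^ (-k) ≤ ε ^ (-(k + 1)) := Real.rpow_le_rpow_of_exponent_ge hε hε1 (by linarith)
    exact mul_le_mul hK'K h1 (Real.rpow_nonneg hε.le _) hK'0.le
  obtain ⟨r, hr2, hrK, hquiet⟩ :=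
    hcol (k + 1) K' (by linarith) hK'1 ε ⟨hε, hε2⟩ (ηq / Λ) Lq hreq1 hLq hreq2
  rw [← hK₁] at hrK
  refine ⟨r, hr2, hrK, fun s hs x hx1 hx2 => (hquiet s hs x hx1 hx2).trans ?_⟩
  -- `ηq/Λ ≤ ηq/(1 + log r)` since `0 < 1 + log r ≤ Λ`
  have hr0 : 0 < r := by linarith
  have hlogr : 0 ≤ Real.log r := Real.log_nonneg (by linarith)
  have hle : 1 + Real.log r ≤ Λ := by
    rw [hΛ]
    have h1 : r ≤ K₁ * ε ^ (-(16 * (k + 1) + 18)) := by linarith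
    linarith [Real.log_le_log hr0 h1]
  exact div_le_div_of_nonneg_left hηq0.le (by linarith) hle

end Summit.NavierStokesRegularity.NavierStokesRegularity.Cruxes.TypeIQuantSubcubicExp.QuietCollar

end
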